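import Literature.NumberTheory.Sieve.DrappeauDispersionCharacterCompletion
import HarnessLib

/-!
# Character sums in a residue class against a smooth weight (Drappeau 2017, §5.3.2) — proved

S. Drappeau, *Sums of Kloosterman sums in arithmetic progressions, and the error term in the
dispersion method*, Proc. London Math. Soc. (3) 114 (2017) 684–732 = arXiv:1504.05549
(`Drappeau2017`; held as `paper:arxiv-1504.05549`, chunks 18–19), evaluation of `𝒮₂` in the proof
of **Theorem 5.1** (`Literature.NumberTheory.Sieve.Drappeau2017_theorem51`):

"(5.18) By Poisson summation, `∑_{m ≡ a₁ā₂n̄₁ (q₁)} α(m)χ₂(m) = (α̂(0)/W) ∑_{b mod W,(b,W)=1,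
b ≡ a₁ā₂n̄₁ (q₁)} χ₂(b) + O_ε(ℛ₂ + W^ε)`, where
`ℛ₂ := (M/W) ∑_{0<|h|≤H} |∑_{b mod W,(b,W)=1, b ≡ a₁ā₂n̄₁ (q₁)} χ₂(b) e(bh/W)|`. … The sum over `b₂`
in (5.18') is a Gauss sum; by [IK], `|∑_{b₂}…| ≤ R^{1/2} ∑_{d∣(h,q₂')} d` … we obtain
`ℛ₂ ≪_ε W^ε τ(q₂)(q₂,q₁^∞) R^{1/2}`."

Here the class-restricted character sums against a smooth weight are estimated with explicit
constants, for any character `χ mod q₂`, any class `j N ≡ 1 (mod q₁)` (`N mod q₁`) and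
`W = [q₁,q₂]`, by a route that avoids the source's factorisation `W = q₁'q₂'`: detecting the class
by the additive characters `mod q₁` turns the twisted class sum `T(h)` into an average of the
complete sums `S(k) = ∑_{j mod W} χ(j)e(jk/W)`, `k = h + t W/q₁`, which vanish unless
`(q₁/g) ∣ k` (`g = (q₁,q₂)`) and are then `(q₁/g)` times a Gauss sum `c_χ(k g/q₁) mod q₂`
(`…CharacterCompletion.norm_charGauss_intCast_le`); exactly `g` values of `t` survive, and
`(q₂, kg/q₁) ≤ g (q₂/g, h)`.  Result:

* `norm_classTwist_le` — `|T(h)| ≤ g (q₂/g, h) (cond χ)^{1/2}` for `h ≠ 0`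
  (`T(h) = ∑_{0 ≤ j < W, jN ≡ 1 (q₁)} χ(j) e(jh/W)`; compare the source's
  `R^{1/2}(q₂,q₁^∞) ∑_{d∣(h,q₂')} d`);
* `norm_tsum_smooth_mul_class_char_sub_le` — for `H ≥ 1`, `n ≥ 2`:
  `|∑_k ψ_M(k) 1[kN ≡ 1 (q₁)] χ(k) − (M'/W) ∑_{0 ≤ b < W, bN ≡ 1 (q₁)} χ(b)|
     ≤ (M/W)(∫|ψ|) · 2 H τ(q₂) g (cond χ)^{1/2} + W · 2 (∫|ψ⁽ⁿ⁾|)(W/(2πM))ⁿ (M/W) H^{1−n}`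
  (Polymath 8a Lemma 4.9, `Polymath8a.completion_truncated`), the estimate consumed by
  `…DrappeauDispersionS2.norm_dispS2_sub_mul_mainX3_le`.

## References

* S. Drappeau, Proc. London Math. Soc. (3) 114 (2017) 684–732, arXiv:1504.05549, §5.3.2
  (5.18)–(5.19). [Drappeau2017]
* D. H. J. Polymath, Algebra & Number Theory 8 (2014) 2067–2199, Lemma 4.9. [Polymath8a2014]
-/

noncomputable section

open Real MeasureTheory Complex Finset
open scoped FourierTransform ContDiff ArithmeticFunction.sigma

namespace Literature.NumberTheory.Sieve

namespace Drappeau2017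

open MontgomeryVaughan1975 (charGauss charGauss_eq_sum sum_range_eq_sum_zmod sum_range_mul_eq
  fourierChar_div_eq_stdAddChar')
open Polymath8a (completion_truncated sum_Icc_neg_eq)

/-! ### Gauss sums at every frequency -/

/-- `|c_χ(a)| ≤ (q, |a|) (cond χ)^{1/2}` for every integer `a` (for `q ∣ a` this is the trivial
bound `|c_χ(0)| ≤ q`). [cite: MontgomeryVaughanActa1975, §5 Lemma 5.4] -/
theorem norm_charGauss_intCast_le' {q : ℕ} [NeZero q] (χ : DirichletCharacter ℂ q) (a : ℤ) :
    ‖charGauss χ (a : ZMod q)‖ ≤ (Nat.gcd q a.natAbs : ℝ) * Real.sqrt χ.conductor := by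
  by_cases ha : a = 0
  · subst ha
    rw [Int.natAbs_zero, Nat.gcd_zero_right, Int.cast_zero, charGauss_eq_sum]
    have h1 : (1 : ℝ) ≤ Real.sqrt χ.conductor := by
      rw [← Real.sqrt_one]
      exact Real.sqrt_le_sqrt (by exact_mod_cast Nat.one_le_iff_ne_zero.2 χ.conductor_ne_zero)
    calc ‖∑ x : ZMod q, χ x * ZMod.stdAddChar (0 * x)‖ ≤ ∑ x : ZMod q, (1 : ℝ) := by
          refine (norm_sum_le _ _).trans (Finset.sum_le_sum fun x _ => ?_)
          rw [norm_mul, (ZMod.stdAddChar (N := q)).norm_apply, mul_one]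
          exact DirichletCharacter.norm_le_one χ x
      _ = q := by simp
      _ ≤ (q : ℝ) * Real.sqrt χ.conductor := le_mul_of_one_le_right (Nat.cast_nonneg q) h1
  · exact norm_charGauss_intCast_le χ ha

/-! ### Additive characters: geometric sums and the class indicator -/

/-- `∑_{0 ≤ v < r} e(vk/r) = r 1_{r ∣ k}`. [folklore] -/
theorem sum_range_fourierChar_mul_div (r : ℕ) [NeZero r] (k : ℤ) :
    ∑ v ∈ Finset.range r, (𝐞 ((((v : ℤ) * k : ℤ) : ℝ) / r) : ℂ) =
      if (r : ℤ) ∣ k then (r : ℂ) else 0 := by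
  have h1 : ∀ v : ℕ, (𝐞 ((((v : ℤ) * k : ℤ) : ℝ) / r) : ℂ) =
      ZMod.stdAddChar ((v : ZMod r) * (k : ZMod r)) := by
    intro v
    rw [fourierChar_div_eq_stdAddChar']
    push_cast
    rfl
  simp only [h1]
  rw [sum_range_eq_sum_zmod (fun x : ZMod r => ZMod.stdAddChar (x * (k : ZMod r))),
    AddChar.sum_mulShift (k : ZMod r) (ZMod.isPrimitive_stdAddChar r), ZMod.card]
  by_cases hk : (r : ℤ) ∣ k
  · rw [if_pos hk, if_pos ((ZMod.intCast_zmod_eq_zero_iff_dvd k r).2 hk)]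
  · rw [if_neg hk, if_neg (fun h0 => hk ((ZMod.intCast_zmod_eq_zero_iff_dvd k r).1 h0)),
      Nat.cast_zero]

/-- **The class indicator through additive characters**: if `c N ≡ 1 (mod q₁)` then for all
integers `j`, `1[jN ≡ 1 (q₁)] = q₁⁻¹ ∑_{0 ≤ t < q₁} e(t(j − c)/q₁)`. [folklore] -/
theorem ite_mul_eq_one_eq_sum_fourierChar {q₁ : ℕ} [NeZero q₁] {N : ZMod q₁} {c : ℤ}
    (hc : (c : ZMod q₁) * N = 1) (j : ℤ) :
    (if (j : ZMod q₁) * N = 1 then (1 : ℂ) else 0) =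
      ((q₁ : ℂ))⁻¹ * ∑ t ∈ Finset.range q₁, (𝐞 ((((t : ℤ) * (j - c) : ℤ) : ℝ) / q₁) : ℂ) := by
  have hN : IsUnit N := IsUnit.of_mul_eq_one_right (c : ZMod q₁) hc
  have hiff : (j : ZMod q₁) * N = 1 ↔ (q₁ : ℤ) ∣ (j - c) := by
    rw [← ZMod.intCast_zmod_eq_zero_iff_dvd, Int.cast_sub, sub_eq_zero]
    constructor
    · intro h
      exact (IsUnit.mul_left_inj hN).1 (h.trans hc.symm)
    · intro h
      rw [h, hc]
  rw [sum_range_fourierChar_mul_div q₁ (j - c)]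
  have hq : (q₁ : ℂ) ≠ 0 := by exact_mod_cast NeZero.ne q₁
  by_cases h : (q₁ : ℤ) ∣ (j - c)
  · rw [if_pos (hiff.2 h), if_pos h, inv_mul_cancel₀ hq]
  · rw [if_neg (fun h' => h (hiff.1 h')), if_neg h, mul_zero]

/-! ### The complete sums `S(k) = ∑_{j mod W} χ(j) e(jk/W)` -/

/-- **`S(k) = (q₁/g) 1_{(q₁/g) ∣ k} c_χ(kg/q₁)`**: for `χ mod q₂` and `W = q₂ r`,
`∑_{0 ≤ j < W} χ(j) e(jk/W) = r c_χ(k/r)` if `r ∣ k` and `0` otherwise (split `j = j₀ + q₂v`).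
[folklore] -/
theorem sum_range_mul_char_fourierChar_eq {q₂ r : ℕ} [NeZero q₂] [NeZero r]
    (χ : DirichletCharacter ℂ q₂) (k : ℤ) :
    ∑ j ∈ Finset.range (q₂ * r), χ ((j : ℤ) : ZMod q₂) * (𝐞 ((((j : ℤ) * k : ℤ) : ℝ) / (q₂ * r : ℕ)) : ℂ) =
      if (r : ℤ) ∣ k then (r : ℂ) * charGauss χ ((k / r : ℤ) : ZMod q₂) else 0 := by
  have hq₂ : (q₂ : ℝ) ≠ 0 := by exact_mod_cast NeZero.ne q₂
  have hr : (r : ℝ) ≠ 0 := by exact_mod_cast NeZero.ne r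
  rw [sum_range_mul_eq _ q₂ r]
  -- the phase splits: `e((j₀ + q₂v)k/(q₂r)) = e(j₀k/(q₂r)) e(vk/r)`
  have hsplit : ∀ j₀ v : ℕ,
      χ (((j₀ + q₂ * v : ℕ) : ℤ) : ZMod q₂) *
          (𝐞 (((((j₀ + q₂ * v : ℕ) : ℤ) * k : ℤ) : ℝ) / (q₂ * r : ℕ)) : ℂ) =
        χ ((j₀ : ℤ) : ZMod q₂) * (𝐞 ((((j₀ : ℤ) * k : ℤ) : ℝ) / (q₂ * r : ℕ)) : ℂ) *
          (𝐞 ((((v : ℤ) * k : ℤ) : ℝ) / r) : ℂ) := by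
    intro j₀ v
    have hχ : χ (((j₀ + q₂ * v : ℕ) : ℤ) : ZMod q₂) = χ ((j₀ : ℤ) : ZMod q₂) := by
      push_cast
      rw [ZMod.natCast_self, zero_mul, add_zero]
    have he : ((((j₀ + q₂ * v : ℕ) : ℤ) * k : ℤ) : ℝ) / (q₂ * r : ℕ) =
        (((j₀ : ℤ) * k : ℤ) : ℝ) / (q₂ * r : ℕ) + (((v : ℤ) * k : ℤ) : ℝ) / r := by
      push_cast
      rw [div_add_div _ _ (mul_ne_zero hq₂ hr) hr, div_eq_div_iff (mul_ne_zero hq₂ hr)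
        (mul_ne_zero (mul_ne_zero hq₂ hr) hr)]
      ring
    rw [hχ, he, AddChar.map_add_eq_mul, Circle.coe_mul, mul_assoc]
  simp only [hsplit, ← Finset.mul_sum, sum_range_fourierChar_mul_div r k, ← Finset.sum_mul]
  split_ifs with hdvd
  · obtain ⟨k', rfl⟩ := hdvd
    have hk' : ((r : ℤ) * k' / r : ℤ) = k' := by
      rw [Int.mul_ediv_cancel_left _ (by exact_mod_cast NeZero.ne r)]
    rw [hk', mul_comm, ← sum_range_mul_fourierChar_eq_charGauss χ k']
    congr 1
    refine Finset.sum_congr rfl fun j₀ _ => ?_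
    congr 3
    push_cast
    rw [div_eq_div_iff (mul_ne_zero hq₂ hr) hq₂]
    ring
  · rw [mul_zero]

/-! ### The twisted class sums `T(h)` -/

/-- Exactly the `t ≡ t₀ (mod r)` in `[0, rg)` satisfy `r ∣ h + tm` when `(m, r) = 1`: the count is
at most `g`. [folklore] -/
theorem card_filter_dvd_add_mul_le {r g m : ℕ} (hm : m.Coprime r) (h : ℤ) :
    ((Finset.range (r * g)).filter (fun t : ℕ => (r : ℤ) ∣ h + t * m)).card ≤ g := by
  -- `t ↦ t / r` is injective on the solutions (two solutions congruent mod `r` with the same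
  -- quotient coincide) and lands in `range g`
  have hsol : ∀ t t' : ℕ, (r : ℤ) ∣ h + t * m → (r : ℤ) ∣ h + t' * m → (t : ℤ) ≡ t' [ZMOD r] := by
    intro t t' ht ht'
    have hd : (r : ℤ) ∣ ((t : ℤ) - t') * m := by
      have := dvd_sub ht ht'
      rwa [show h + (t : ℤ) * m - (h + t' * m) = ((t : ℤ) - t') * m by ring] at this
    have hcop : IsCoprime (r : ℤ) (m : ℤ) := by
      rw [Int.isCoprime_iff_gcd_eq_one, Int.gcd_natCast_natCast]
      exact hm.symm
    exact Int.modEq_iff_dvd.2 (dvd_sub_comm.1 (hcop.dvd_of_dvd_mul_right hd))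
  calc ((Finset.range (r * g)).filter (fun t : ℕ => (r : ℤ) ∣ h + t * m)).card
      ≤ (Finset.range g).card := by
        refine Finset.card_le_card_of_injOn (fun t => t / r) (fun t ht => ?_) ?_
        · have := Finset.mem_range.1 (Finset.mem_filter.1 ht).1
          exact Finset.mem_coe.2 (Finset.mem_range.2 (Nat.div_lt_of_lt_mul this))
        · intro t ht t' ht' hq
          have hmod : t % r = t' % r := by
            have := hsol t t' (Finset.mem_filter.1 ht).2 (Finset.mem_filter.1 ht').2
            unfold Int.ModEq at this
            exact_mod_cast this
          have hq' : t / r = t' / r := hq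
          calc t = r * (t / r) + t % r := (Nat.div_add_mod t r).symm
            _ = r * (t' / r) + t' % r := by rw [hq', hmod]
            _ = t' := Nat.div_add_mod t' r
    _ = g := Finset.card_range g

/-- **The twisted class sums**: for `χ mod q₂`, `N mod q₁`, `W = [q₁,q₂]`, `g = (q₁,q₂)` and an
integer `h ≠ 0`,
`|∑_{0 ≤ j < W, jN ≡ 1 (q₁)} χ(j) e(jh/W)| ≤ g · (q₂/g, |h|) · (cond χ)^{1/2}`
(the source bounds the same sums by `R^{1/2} (q₂, q₁^∞) ∑_{d ∣ (h,q₂')} d`, (5.18)–(5.19)).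
[cite: Drappeau2017, §5.3.2 (5.18)–(5.19)] -/
theorem norm_classTwist_le {q₁ q₂ : ℕ} [NeZero q₁] [NeZero q₂] (N : ZMod q₁)
    (χ : DirichletCharacter ℂ q₂) {h : ℤ} :
    ‖∑ j ∈ Finset.range (Nat.lcm q₁ q₂),
        (if ((j : ℤ) : ZMod q₁) * N = 1 then χ ((j : ℤ) : ZMod q₂) else 0) *
          (𝐞 (((j : ℤ) : ℝ) * h / (Nat.lcm q₁ q₂ : ℕ)) : ℂ)‖ ≤
      (Nat.gcd q₁ q₂ : ℝ) * (Nat.gcd (q₂ / Nat.gcd q₁ q₂) h.natAbs : ℝ) * Real.sqrt χ.conductor := by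
  classical
  -- notation: `g = (q₁,q₂)`, `q₁ = g r`, `q₂ = g m`, `W = q₂ r`, `(r, m) = 1`
  have hq₁ : 0 < q₁ := Nat.pos_of_ne_zero (NeZero.ne q₁)
  have hq₂ : 0 < q₂ := Nat.pos_of_ne_zero (NeZero.ne q₂)
  set g := Nat.gcd q₁ q₂ with hg
  set r := q₁ / g with hr
  set m := q₂ / g with hm
  have hg0 : 0 < g := Nat.gcd_pos_of_pos_left q₂ hq₁
  have hgr : g * r = q₁ := Nat.mul_div_cancel' (Nat.gcd_dvd_left q₁ q₂)
  have hgm : g * m = q₂ := Nat.mul_div_cancel' (Nat.gcd_dvd_right q₁ q₂)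
  have hr0 : 0 < r := Nat.pos_of_ne_zero fun h0 => by rw [h0, mul_zero] at hgr; omega
  have hm0 : 0 < m := Nat.pos_of_ne_zero fun h0 => by rw [h0, mul_zero] at hgm; omega
  haveI : NeZero r := ⟨hr0.ne'⟩
  have hcop : r.Coprime m := Nat.coprime_div_gcd_div_gcd hg0
  have hL : Nat.lcm q₁ q₂ = q₂ * r := by
    have h1 := Nat.gcd_mul_lcm q₁ q₂
    rw [← hg] at h1
    have h2 : g * (q₂ * r) = q₁ * q₂ := by rw [← hgr]; ring
    exact Nat.eq_of_mul_eq_mul_left hg0 (h1.trans h2.symm)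
  rw [hL]
  by_cases hN : IsUnit N
  swap
  · -- no `j` lies in the class
    rw [Finset.sum_eq_zero fun j _ => ?_, norm_zero]
    · positivity
    · rw [if_neg (fun h1 => hN (IsUnit.of_mul_eq_one_right _ h1)), zero_mul]
  -- an integer `c` with `c N ≡ 1`
  obtain ⟨c, hc⟩ : ∃ c : ℤ, (c : ZMod q₁) * N = 1 :=
    ⟨((hN.unit⁻¹ : (ZMod q₁)ˣ) : ZMod q₁).val, by
      rw [Int.cast_natCast, ZMod.natCast_zmod_val]
      exact hN.unit.inv_mul⟩
  -- real forms of the moduli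
  have hq₁R : (q₁ : ℝ) = g * r := by exact_mod_cast hgr.symm
  have hq₂R : (q₂ : ℝ) = g * m := by exact_mod_cast hgm.symm
  have hg0R : (g : ℝ) ≠ 0 := by exact_mod_cast hg0.ne'
  have hr0R : (r : ℝ) ≠ 0 := by exact_mod_cast hr0.ne'
  have hm0R : (m : ℝ) ≠ 0 := by exact_mod_cast hm0.ne'
  -- the complete sums `S(k)`
  set S : ℤ → ℂ := fun k => ∑ j ∈ Finset.range (q₂ * r),
    χ ((j : ℤ) : ZMod q₂) * (𝐞 ((((j : ℤ) * k : ℤ) : ℝ) / (q₂ * r : ℕ)) : ℂ) with hS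
  -- Step 1: detect the class additively and exchange the sums
  have hphase : ∀ j t : ℕ,
      (𝐞 ((((t : ℤ) * ((j : ℤ) - c) : ℤ) : ℝ) / q₁) : ℂ) * (𝐞 (((j : ℤ) : ℝ) * h / (q₂ * r : ℕ)) : ℂ) =
        (𝐞 (-((((t : ℤ) * c : ℤ) : ℝ) / q₁)) : ℂ) *
          (𝐞 ((((j : ℤ) * (h + t * m) : ℤ) : ℝ) / (q₂ * r : ℕ)) : ℂ) := by
    intro j t
    rw [← Circle.coe_mul, ← Circle.coe_mul, ← AddChar.map_add_eq_mul, ← AddChar.map_add_eq_mul]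
    congr 2
    push_cast
    rw [hq₁R, hq₂R]
    field_simp
    ring
  have hT : ∑ j ∈ Finset.range (q₂ * r),
      (if ((j : ℤ) : ZMod q₁) * N = 1 then χ ((j : ℤ) : ZMod q₂) else 0) *
        (𝐞 (((j : ℤ) : ℝ) * h / (q₂ * r : ℕ)) : ℂ) =
      ((q₁ : ℂ))⁻¹ * ∑ t ∈ Finset.range q₁, (𝐞 (-((((t : ℤ) * c : ℤ) : ℝ) / q₁)) : ℂ) * S (h + t * m) := by
    have hsummand : ∀ j : ℕ, (if ((j : ℤ) : ZMod q₁) * N = 1 then χ ((j : ℤ) : ZMod q₂) else 0) *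
        (𝐞 (((j : ℤ) : ℝ) * h / (q₂ * r : ℕ)) : ℂ) =
        ((q₁ : ℂ))⁻¹ * ∑ t ∈ Finset.range q₁, (𝐞 (-((((t : ℤ) * c : ℤ) : ℝ) / q₁)) : ℂ) *
          (χ ((j : ℤ) : ZMod q₂) * (𝐞 ((((j : ℤ) * (h + t * m) : ℤ) : ℝ) / (q₂ * r : ℕ)) : ℂ)) := by
      intro j
      have e1 : (if ((j : ℤ) : ZMod q₁) * N = 1 then χ ((j : ℤ) : ZMod q₂) else 0) *
          (𝐞 (((j : ℤ) : ℝ) * h / (q₂ * r : ℕ)) : ℂ) =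
          χ ((j : ℤ) : ZMod q₂) * (𝐞 (((j : ℤ) : ℝ) * h / (q₂ * r : ℕ)) : ℂ) *
            (if ((j : ℤ) : ZMod q₁) * N = 1 then (1 : ℂ) else 0) := by
        split_ifs <;> simp
      rw [e1, ite_mul_eq_one_eq_sum_fourierChar hc (j : ℤ), ← mul_assoc, Finset.mul_sum,
        Finset.mul_sum]
      refine Finset.sum_congr rfl fun t _ => ?_
      calc χ ((j : ℤ) : ZMod q₂) * (𝐞 (((j : ℤ) : ℝ) * h / (q₂ * r : ℕ)) : ℂ) * ((q₁ : ℂ))⁻¹ *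
            (𝐞 ((((t : ℤ) * ((j : ℤ) - c) : ℤ) : ℝ) / q₁) : ℂ)
          = ((q₁ : ℂ))⁻¹ * χ ((j : ℤ) : ZMod q₂) *
              ((𝐞 ((((t : ℤ) * ((j : ℤ) - c) : ℤ) : ℝ) / q₁) : ℂ) *
                (𝐞 (((j : ℤ) : ℝ) * h / (q₂ * r : ℕ)) : ℂ)) := by ring
        _ = ((q₁ : ℂ))⁻¹ * χ ((j : ℤ) : ZMod q₂) *
              ((𝐞 (-((((t : ℤ) * c : ℤ) : ℝ) / q₁)) : ℂ) *
                (𝐞 ((((j : ℤ) * (h + t * m) : ℤ) : ℝ) / (q₂ * r : ℕ)) : ℂ)) := by rw [hphase j t]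
        _ = _ := by ring
    rw [Finset.sum_congr rfl fun j _ => hsummand j, ← Finset.mul_sum, Finset.sum_comm]
    congr 1
    refine Finset.sum_congr rfl fun t _ => ?_
    rw [hS, Finset.mul_sum]
  -- Step 2: the size of `S(h + tm)`
  set B : ℝ := (g : ℝ) * (Nat.gcd m h.natAbs : ℝ) * Real.sqrt χ.conductor with hB
  have hB0 : 0 ≤ B := by positivity
  have hSle : ∀ t : ℕ, ‖S (h + t * m)‖ ≤ if (r : ℤ) ∣ h + t * m then (r : ℝ) * B else 0 := by
    intro t
    simp only [hS]
    rw [sum_range_mul_char_fourierChar_eq χ (h + t * m)]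
    split_ifs with hdvd
    · obtain ⟨y, hy⟩ := hdvd
      have hyq : (h + t * m) / r = y := by
        rw [hy, Int.mul_ediv_cancel_left _ (by exact_mod_cast hr0.ne')]
      rw [hyq, norm_mul, Complex.norm_natCast]
      refine mul_le_mul_of_nonneg_left ((norm_charGauss_intCast_le' χ y).trans ?_) (Nat.cast_nonneg r)
      -- `(q₂, |y|) ≤ g (m, |y|)` and `(m, |y|) = (m, |h|)`
      have h1 : Nat.gcd q₂ y.natAbs ≤ g * Nat.gcd m y.natAbs := by
        rw [← hgm, Nat.gcd_comm (g * m), Nat.gcd_comm m]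
        refine (Nat.le_of_dvd (Nat.pos_of_ne_zero (mul_ne_zero (Nat.gcd_ne_zero_right hg0.ne')
          (Nat.gcd_ne_zero_right hm0.ne'))) (Nat.gcd_mul_right_dvd_mul_gcd _ _ _)).trans ?_
        exact Nat.mul_le_mul_right _ (Nat.gcd_le_right _ hg0)
      have h2 : Nat.gcd m y.natAbs = Nat.gcd m h.natAbs := by
        have e1 : Nat.gcd m y.natAbs = Nat.gcd m ((r : ℤ) * y).natAbs := by
          rw [Int.natAbs_mul, Int.natAbs_natCast, Nat.Coprime.gcd_mul_left_cancel_right _ hcop]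
        rw [e1, ← hy]
        have e2 : Int.gcd (m : ℤ) (h + t * m) = Int.gcd (m : ℤ) h := Int.gcd_add_mul_right_right _ _ _
        simpa [Int.gcd, Int.natAbs_natCast] using e2
      rw [hB]
      refine mul_le_mul_of_nonneg_right ?_ (Real.sqrt_nonneg _)
      calc (Nat.gcd q₂ y.natAbs : ℝ) ≤ ((g * Nat.gcd m y.natAbs : ℕ) : ℝ) := by exact_mod_cast h1
        _ = (g : ℝ) * (Nat.gcd m h.natAbs : ℝ) := by rw [h2]; push_cast; ring
    · rw [norm_zero]
  -- Step 3: at most `g` values of `t` survive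
  have hcount : ∑ t ∈ Finset.range q₁, (if (r : ℤ) ∣ h + t * m then (r : ℝ) * B else 0) ≤
      g * ((r : ℝ) * B) := by
    rw [← Finset.sum_filter, Finset.sum_const, nsmul_eq_mul]
    refine mul_le_mul_of_nonneg_right ?_ (by positivity)
    have hc' := card_filter_dvd_add_mul_le (g := g) hcop.symm h
    rw [show r * g = q₁ by rw [mul_comm]; exact hgr] at hc'
    exact_mod_cast hc'
  -- Step 4: assemble
  rw [hT, norm_mul, norm_inv, Complex.norm_natCast]
  calc (q₁ : ℝ)⁻¹ * ‖∑ t ∈ Finset.range q₁, (𝐞 (-((((t : ℤ) * c : ℤ) : ℝ) / q₁)) : ℂ) * S (h + t * m)‖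
      ≤ (q₁ : ℝ)⁻¹ * ∑ t ∈ Finset.range q₁, (if (r : ℤ) ∣ h + t * m then (r : ℝ) * B else 0) := by
        refine mul_le_mul_of_nonneg_left ((norm_sum_le _ _).trans
          (Finset.sum_le_sum fun t _ => ?_)) (by positivity)
        rw [norm_mul, Circle.norm_coe, one_mul]
        exact hSle t
    _ ≤ (q₁ : ℝ)⁻¹ * (g * ((r : ℝ) * B)) := mul_le_mul_of_nonneg_left hcount (by positivity)
    _ = B := by
        rw [hq₁R]
        field_simp
    _ = _ := by rw [hB]

/-- **Character sums in a residue class against a smooth weight** (Drappeau §5.3.2, (5.18) with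
the bound on `ℛ₂`, by completion of sums and `norm_classTwist_le`): for `χ mod q₂`, `N mod q₁`
(`qⱼ ≥ 1`), `W = [q₁,q₂]`, `g = (q₁,q₂)`, a smooth compactly supported `ψ`, `M > 0`, `x₀`, `H ≥ 1`
and `n ≥ 2`,
`|∑_{k ∈ ℤ} ψ((k−x₀)/M) 1[kN ≡ 1 (q₁)] χ(k) − (M'/W) ∑_{0 ≤ b < W, bN ≡ 1 (q₁)} χ(b)|
  ≤ (M/W)(∫|ψ|) · (2 H τ(q₂/g) g (cond χ)^{1/2}) + W · (2 (∫|ψ⁽ⁿ⁾|)(W/(2πM))ⁿ (M/W) H^{1−n})`,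
`M' = ∑_m ψ((m−x₀)/M)`. [cite: Drappeau2017, §5.3.2 (5.18)] -/
theorem norm_tsum_smooth_mul_class_char_sub_le {q₁ q₂ : ℕ} [NeZero q₁] [NeZero q₂]
    (N : ZMod q₁) (χ : DirichletCharacter ℂ q₂) {ψ : ℝ → ℂ} (hψ : ContDiff ℝ ∞ ψ)
    (hψc : HasCompactSupport ψ) {M : ℝ} (hM : 0 < M) (x₀ : ℝ) {H : ℕ} (hH : 1 ≤ H) {n : ℕ}
    (hn : 2 ≤ n) :
    ‖∑' k : ℤ, ψ ((k - x₀) / M) * (if ((k : ℤ) : ZMod q₁) * N = 1 then χ ((k : ℤ) : ZMod q₂) else 0) -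
        (∑' m : ℤ, ψ ((m - x₀) / M)) / (Nat.lcm q₁ q₂ : ℂ) *
          ∑ j ∈ Finset.range (Nat.lcm q₁ q₂),
            (if ((j : ℤ) : ZMod q₁) * N = 1 then χ ((j : ℤ) : ZMod q₂) else 0)‖ ≤
      M / (Nat.lcm q₁ q₂) * (∫ t, ‖ψ t‖) *
          (2 * H * (σ 0 (q₂ / Nat.gcd q₁ q₂) : ℝ) * (Nat.gcd q₁ q₂) * Real.sqrt χ.conductor) +
        (Nat.lcm q₁ q₂) * (2 * (∫ t, ‖iteratedDeriv n ψ t‖) *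
          ((Nat.lcm q₁ q₂ : ℝ) / (2 * π * M)) ^ n * (M / (Nat.lcm q₁ q₂)) * ((H : ℝ) ^ (n - 1))⁻¹) := by
  have hq₁ : 0 < q₁ := Nat.pos_of_ne_zero (NeZero.ne q₁)
  have hq₂ : 0 < q₂ := Nat.pos_of_ne_zero (NeZero.ne q₂)
  have hL : 0 < Nat.lcm q₁ q₂ := Nat.lcm_pos hq₁ hq₂
  haveI : NeZero (Nat.lcm q₁ q₂) := ⟨hL.ne'⟩
  have hm0 : q₂ / Nat.gcd q₁ q₂ ≠ 0 := fun h0 => by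
    have := Nat.mul_div_cancel' (Nat.gcd_dvd_right q₁ q₂)
    rw [h0, mul_zero] at this
    omega
  have hper : ∀ m k : ℤ,
      (fun m : ℤ => if ((m : ℤ) : ZMod q₁) * N = 1 then χ ((m : ℤ) : ZMod q₂) else 0)
          (m + (Nat.lcm q₁ q₂ : ℕ) * k) =
        (fun m : ℤ => if ((m : ℤ) : ZMod q₁) * N = 1 then χ ((m : ℤ) : ZMod q₂) else 0) m := by
    intro m k
    have h₁ : ((Nat.lcm q₁ q₂ : ℕ) : ZMod q₁) = 0 :=
      (ZMod.natCast_eq_zero_iff _ _).2 (Nat.dvd_lcm_left q₁ q₂)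
    have h₂ : ((Nat.lcm q₁ q₂ : ℕ) : ZMod q₂) = 0 :=
      (ZMod.natCast_eq_zero_iff _ _).2 (Nat.dvd_lcm_right q₁ q₂)
    simp only
    push_cast
    rw [h₁, h₂, zero_mul, zero_mul, add_zero, add_zero]
  have h := completion_truncated hψ hψc hM x₀ Nat.one_pos hL 0
    (g := fun m : ℤ => if ((m : ℤ) : ZMod q₁) * N = 1 then χ ((m : ℤ) : ZMod q₂) else 0) hper hH hn
  simp only [Nat.cast_one, Int.cast_zero, zero_add, one_mul] at h
  refine h.trans (add_le_add ?_ ?_)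
  · -- the twisted class sums
    refine mul_le_mul_of_nonneg_left ?_ (by positivity)
    rw [Finset.sum_filter, sum_Icc_neg_eq]
    simp only [dvd_zero, not_true, if_false, zero_add]
    set B : ℝ := (Nat.gcd q₁ q₂ : ℝ) * Real.sqrt χ.conductor with hB
    calc ∑ ν ∈ Finset.Icc 1 H, ((if ¬ ((Nat.lcm q₁ q₂ : ℕ) : ℤ) ∣ (ν : ℤ) then
            ‖∑ j ∈ Finset.range (Nat.lcm q₁ q₂),
                (if ((j : ℤ) : ZMod q₁) * N = 1 then χ ((j : ℤ) : ZMod q₂) else 0) *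
                  (𝐞 (((j : ℤ) : ℝ) * (ν : ℤ) / (Nat.lcm q₁ q₂ : ℕ)) : ℂ)‖ else 0) +
            (if ¬ ((Nat.lcm q₁ q₂ : ℕ) : ℤ) ∣ -(ν : ℤ) then
            ‖∑ j ∈ Finset.range (Nat.lcm q₁ q₂),
                (if ((j : ℤ) : ZMod q₁) * N = 1 then χ ((j : ℤ) : ZMod q₂) else 0) *
                  (𝐞 (((j : ℤ) : ℝ) * (-(ν : ℤ) : ℤ) / (Nat.lcm q₁ q₂ : ℕ)) : ℂ)‖ else 0))
        ≤ ∑ ν ∈ Finset.Icc 1 H, 2 * ((Nat.gcd (q₂ / Nat.gcd q₁ q₂) ν : ℝ) * B) := by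
          refine Finset.sum_le_sum fun ν hν => ?_
          have b1 := norm_classTwist_le N χ (h := (ν : ℤ))
          have b2 := norm_classTwist_le N χ (h := -(ν : ℤ))
          rw [Int.natAbs_neg] at b2
          rw [Int.natAbs_natCast] at b1 b2
          have g0 : 0 ≤ (Nat.gcd (q₂ / Nat.gcd q₁ q₂) ν : ℝ) * B := by positivity
          have e : (Nat.gcd q₁ q₂ : ℝ) * (Nat.gcd (q₂ / Nat.gcd q₁ q₂) ν : ℝ) * Real.sqrt χ.conductor =
              (Nat.gcd (q₂ / Nat.gcd q₁ q₂) ν : ℝ) * B := by rw [hB]; ring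
          rw [e] at b1 b2
          split_ifs <;> push_cast at b1 b2 ⊢ <;> linarith
      _ = 2 * B * ∑ ν ∈ Finset.Icc 1 H, (Nat.gcd (q₂ / Nat.gcd q₁ q₂) ν : ℝ) := by
          rw [Finset.mul_sum]
          refine Finset.sum_congr rfl fun ν _ => ?_
          ring
      _ ≤ 2 * B * (H * (σ 0 (q₂ / Nat.gcd q₁ q₂) : ℝ)) :=
          mul_le_mul_of_nonneg_left (sum_Icc_gcd_le _ H hm0) (by positivity)
      _ = 2 * H * (σ 0 (q₂ / Nat.gcd q₁ q₂) : ℝ) * (Nat.gcd q₁ q₂) * Real.sqrt χ.conductor := by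
          rw [hB]; ring
  · -- the complete sum of `|g|`
    refine mul_le_mul_of_nonneg_right ?_ ?_
    · calc ∑ j ∈ Finset.range (Nat.lcm q₁ q₂),
            ‖(if ((j : ℤ) : ZMod q₁) * N = 1 then χ ((j : ℤ) : ZMod q₂) else 0)‖
          ≤ ∑ j ∈ Finset.range (Nat.lcm q₁ q₂), (1 : ℝ) := by
            refine Finset.sum_le_sum fun j _ => ?_
            split_ifs
            · exact DirichletCharacter.norm_le_one χ _
            · simp
        _ = Nat.lcm q₁ q₂ := by simp
    · have : 0 ≤ ∫ t, ‖iteratedDeriv n ψ t‖ := integral_nonneg fun _ => norm_nonneg _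
      positivity

end Drappeau2017

end Literature.NumberTheory.Sieve

end
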